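import Summits.AtomisticToContinuum.BoseEinsteinCondensation.Theses.BECConjugateDomination
import Summits.AtomisticToContinuum.BoseEinsteinCondensation.Theorems.DensityResponse.Negative.PeriodisedWell
import Literature.MathematicalPhysics.QuantumManyBody.PeriodicHeatFlowSpectral
import Literature.MathematicalPhysics.QuantumManyBody.PeriodicFeynmanKacTrialState
import HarnessLib

/-!
# Positive `C¹` minimisers for bounded potentials on the torus: stub `stub_boundedPositiveMinimiser`
# (S6) of line `third-law-current-floor` for crux `HardCoreExtension` (stmt-AtomisticToContinuum-11786),
# conditional on the Feynman–Kac package and elliptic regularity (skeleton v2)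

Stub S6 of the skeleton `Cruxes/HardCoreExtension/Lines/third-law-current-floor.lean` asks, for every
BOUNDED admissible pair potential `v` (measurable, finite range, `v ≤ M < ⊤`), every `n` and `L > 0`,
for a minimiser of the periodic `(n+1)`-body energy in the `C¹` periodic Bose class
`PeriodicTrialState (n+1) L` which has finite energy and is pointwise strictly positive.

The registered (unconditional) signature is NOT proved here: it rests on two facts of the standard
theory that the tree does not yet prove,

* (α) the named fact `PeriodicGroundStateFeynmanKac` of `PeriodicHeatFlowSpectral.lean` (the
  Perron–Frobenius / Feynman–Kac ground state `Ψ₀` of `-Δ + ∑ v^per` on the torus for bounded `v^per`: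
  a witness of `IsPeriodicGroundStateFK v L Ψ₀`, continuous and strictly positive; its Dirichlet twin
  `GroundStateFeynmanKac_holds` is proved, the periodic port stops at `PeriodicFeynmanKacTrialState` /
  `PeriodicFeynmanKacPerronFrobenius`, the assembly is missing), and
* (β) `C¹`-regularity of that witness (elliptic regularity: `(-Δ + V)Ψ₀ = E₀Ψ₀` with `VΨ₀ ∈ L^∞`
  gives `Ψ₀ ∈ W^{2,p}` for all `p`, hence `C^{1,α}`), taken below as an explicit (inlined) hypothesis.

What IS proved here (sorry-free):

* `exists_periodizedPotential_le` — a bounded finite-range `v` has a BOUNDED periodisation on every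
  torus `L > 0` (comparison with the periodised square well of
  `Theorems/DensityResponse/Negative/PeriodisedWell.lean`), so (α) applies to the stub's class;
* `positiveMinimiser_of_isPeriodicGroundStateFK` — the gap (γ) is closed: a `C¹` witness of
  `IsPeriodicGroundStateFK v L Ψ₀` which is strictly positive IS a minimiser of `periodicEnergy v` over
  `PeriodicTrialState N L`, of finite energy, real and positive. The energy identity
  `𝓔^per[Ψ₀] = E₀` is the Fatou bound `∫_cell|∇Ψ₀|² ≤ liminf sqIncrCell/(2t)`
  (`kinetic_le_liminf_sqIncrCell`) against the eigenfunction bound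
  `limsup sqIncrCell/(2t) ≤ E₀ - ∫_cell V^perΨ₀²` (`sqIncrCell_div_eventually_le`), the integrated
  eigen-relation `⟨Ψ₀, e^{-tH}Ψ₀⟩_cell = e^{-E₀t}` being read off `IsPeriodicGroundStateFK.eigen`;
* `stub_boundedPositiveMinimiser` — the registered stub of skeleton v2: the v1 statement CONDITIONAL on (α) and
  (β), both taken as hypotheses ((β) inlined as a Prop; no new definition is introduced here);
* `stub_boundedPositiveMinimiser_zero` — the unconditional case `n = 0` (`N = 1`: the constant state).
-/

noncomputable section

namespace Summit.AtomisticToContinuum.BoseEinsteinCondensation.Cruxes.HardCoreExtension.ThirdLawCurrentFloor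

open MeasureTheory Filter
open scoped ENNReal NNReal BigOperators Topology
open Literature.MathematicalPhysics.QuantumManyBody.BoseGas
open Summit.AtomisticToContinuum.BoseEinsteinCondensation.Theorems.DensityResponse.Negative
  (sqWell ω₃ periodizedPotential_sqWell_le)

/-! ## Bounded finite-range potentials have bounded periodisation -/

/-- **A bounded finite-range potential has a bounded periodisation** on every torus of side `L > 0`:
`v ≤ M·1_{[0,R]}` pointwise, and the periodised square well is bounded by `M ω₃ (R/L + 1)³`
(finitely many lattice images meet a ball). [folklore] -/
theorem exists_periodizedPotential_le {v : ℝ → ℝ≥0∞} (hv : IsRepulsiveFiniteRange v)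
    (hM : ∃ M : ℝ≥0∞, M ≠ ⊤ ∧ ∀ r, v r ≤ M) {L : ℝ} (hL : 0 < L) :
    ∃ C : ℝ≥0, ∀ x, periodizedPotential v L x ≤ C := by
  obtain ⟨-, R₀, hR₀⟩ := hv
  obtain ⟨M, hMtop, hvM⟩ := hM
  set R : ℝ := max R₀ 0 with hRdef
  set K : ℝ := M.toReal with hKdef
  have hle : ∀ r, v r ≤ sqWell K R r := by
    intro r
    by_cases hr : r ≤ R
    · have h1 : sqWell K R r = ENNReal.ofReal K := Set.indicator_of_mem (Set.mem_Iic.2 hr) _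
      rw [h1, hKdef, ENNReal.ofReal_toReal hMtop]
      exact hvM r
    · rw [hR₀ r (lt_of_le_of_lt (le_max_left _ _) (lt_of_not_ge hr))]
      exact bot_le
  refine ⟨(K * ((R / L + 1) ^ 3 * ω₃)).toNNReal, fun x => ?_⟩
  change periodizedPotential v L x ≤ ENNReal.ofReal (K * ((R / L + 1) ^ 3 * ω₃))
  -- monotonicity of the periodisation in the profile (termwise comparison of the lattice sum;
  -- the tree's `periodizedPotential_mono'` / `periodizedPotential_mono_of_le`, inlined to keep imports light)
  calc periodizedPotential v L x ≤ periodizedPotential (sqWell K R) L x :=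
        ENNReal.tsum_le_tsum fun _ => hle _
    _ ≤ ENNReal.ofReal (K * ((R / L + 1) ^ 3 * ω₃)) :=
        periodizedPotential_sqWell_le ENNReal.toReal_nonneg (le_max_right _ _) hL x

/-! ## (γ) From a `C¹` Feynman–Kac ground state to a positive minimiser -/

section GroundState

variable {N : ℕ} {L : ℝ} {v : ℝ → ℝ≥0∞} {Ψ₀ : Config N → ℝ}

/-- The normalisation of a continuous Feynman–Kac ground state in real form: `∫_cell Ψ₀² = 1`.
[folklore] -/
theorem integral_cellN_sq_eq_one_of_isPeriodicGroundStateFK (hL : 0 < L)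
    (hGS : IsPeriodicGroundStateFK v L Ψ₀) (hcont : Continuous Ψ₀) :
    ∫ X in cellN N L, Ψ₀ X ^ 2 = 1 := by
  obtain ⟨M, -, hM⟩ := exists_bound_of_continuous_periodic hL hcont hGS.periodic
  have hsq : Integrable (fun X => Ψ₀ X ^ 2) (volume.restrict (cellN N L)) :=
    (memLp_two_cellN_of_bound L hcont.measurable hM).integrable_sq
  have h1 : ENNReal.ofReal (∫ X in cellN N L, Ψ₀ X ^ 2) = 1 := by
    rw [ofReal_integral_eq_lintegral_ofReal hsq (Eventually.of_forall fun X => sq_nonneg _),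
      ← hGS.norm_eq]
    refine lintegral_congr fun X => ?_
    rw [ENNReal.ofReal_pow (hGS.nonneg X)]
  have h2 := congrArg ENNReal.toReal h1
  rwa [ENNReal.toReal_ofReal (integral_nonneg fun X => sq_nonneg _), ENNReal.toReal_one] at h2

/-- **The integrated eigen-relation** of a continuous Feynman–Kac ground state:
`⟨Ψ₀, e^{-tH}Ψ₀⟩_cell = e^{-E₀ t}` for `t ≥ 0`, `E₀ = periodicGroundStateEnergy v N L` (the pointwise
eigen-relation `e^{-tH}Ψ₀ = e^{-E₀t}Ψ₀` integrated against `Ψ₀` on the cell). [folklore] -/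
theorem integral_cellN_mul_pfkReal_of_isPeriodicGroundStateFK (hL : 0 < L) (hv : Measurable v)
    (hGS : IsPeriodicGroundStateFK v L Ψ₀) (hcont : Continuous Ψ₀) {t : ℝ} (ht : 0 ≤ t) :
    ∫ X in cellN N L, Ψ₀ X * pfkReal v L t Ψ₀ X =
      Real.exp (-((periodicGroundStateEnergy v N L).toReal * t)) := by
  have hpt : ∀ X, Ψ₀ X * pfkReal v L t Ψ₀ X =
      Real.exp (-((periodicGroundStateEnergy v N L).toReal * t)) * Ψ₀ X ^ 2 := by
    intro X
    rw [pfkReal_eq_toReal_periodicFKSemigroup hv L t hcont.measurable hGS.nonneg X, hGS.eigen t ht X,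
      ENNReal.toReal_ofReal (mul_nonneg (Real.exp_pos _).le (hGS.nonneg X))]
    ring
  simp_rw [hpt]
  rw [integral_const_mul, integral_cellN_sq_eq_one_of_isPeriodicGroundStateFK hL hGS hcont, mul_one]

/-- **A `C¹`, strictly positive Feynman–Kac ground state is a positive minimiser of the periodic
energy** (gap (γ) closed). For `L > 0`, `v` measurable with `v^per ≤ C`, and a witness `Ψ₀` of
`IsPeriodicGroundStateFK v L Ψ₀` which is `C¹` and pointwise strictly positive, the periodic trial
state `X ↦ Ψ₀ X` attains `periodicGroundStateEnergy v N L`, has finite energy, is real nonnegative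
(`Ψ = ‖Ψ‖`) and nowhere zero. The inequality `𝓔^per[Ψ₀] ≤ E₀`: the potential part is
`∫_cell Ψ₀² V^per ≤ E₀` and the kinetic part is at most `E₀ - ∫_cell Ψ₀² V^per` by Fatou
(`kinetic_le_liminf_sqIncrCell`) and the eigenfunction bound (`sqIncrCell_div_eventually_le`).
[cite: ChungZhao1995, Thm 3.27 and Prop 3.29 (81)] -/
theorem positiveMinimiser_of_isPeriodicGroundStateFK (hL : 0 < L) (hv : Measurable v) {C : ℝ≥0}
    (hC : ∀ x, periodizedPotential v L x ≤ C) (hGS : IsPeriodicGroundStateFK v L Ψ₀)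
    (hC1 : ContDiff ℝ 1 Ψ₀) (hpos : ∀ X, 0 < Ψ₀ X) :
    ∃ Ψ : PeriodicTrialState N L,
      periodicEnergy v Ψ = periodicGroundStateEnergy v N L ∧ periodicEnergy v Ψ ≠ ⊤ ∧
      (∀ X, Ψ.ψ X = (‖Ψ.ψ X‖ : ℂ)) ∧ (∀ X, Ψ.ψ X ≠ 0) := by
  have hcont : Continuous Ψ₀ := hC1.continuous
  have hper := hGS.periodic
  have hnn := hGS.nonneg
  have hΨm : Measurable Ψ₀ := hcont.measurable
  obtain ⟨M, -, hM⟩ := exists_bound_of_continuous_periodic hL hcont hper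
  have hsq : Integrable (fun X => Ψ₀ X ^ 2) (volume.restrict (cellN N L)) :=
    (memLp_two_cellN_of_bound L hΨm hM).integrable_sq
  have hnorm : ∫ X in cellN N L, Ψ₀ X ^ 2 = 1 :=
    integral_cellN_sq_eq_one_of_isPeriodicGroundStateFK hL hGS hcont
  -- the eigenvalue in real form
  set lam : ℝ := (periodicGroundStateEnergy v N L).toReal with hlam
  have hE₀ : periodicGroundStateEnergy v N L = ENNReal.ofReal lam :=
    (ENNReal.ofReal_toReal hGS.energy_ne_top).symm
  have heig : ∀ t : ℝ, 0 < t →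
      Real.exp (-(lam * t)) ≤ ∫ X in cellN N L, Ψ₀ X * pfkReal v L t Ψ₀ X := fun t ht =>
    (integral_cellN_mul_pfkReal_of_isPeriodicGroundStateFK hL hv hGS hcont ht.le).ge
  -- the potential part
  set Pot : ℝ := ∫ X in cellN N L, Ψ₀ X ^ 2 * (periodicInteraction v L X).toReal with hPot
  have hPot0 : 0 ≤ Pot := integral_nonneg fun X => mul_nonneg (sq_nonneg _) ENNReal.toReal_nonneg
  have hPotle : Pot ≤ lam :=
    setIntegral_cellN_sq_mul_periodicInteraction_le hv hL hC hcont hper hnn hnorm heig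
  have hpotE : ∫⁻ X in cellN N L, ENNReal.ofReal (Ψ₀ X ^ 2) * periodicInteraction v L X =
      ENNReal.ofReal Pot :=
    setLIntegral_cellN_sq_mul_periodicInteraction_eq_ofReal hv hC hΨm hsq
  -- the kinetic part: Fatou against the eigenfunction bound
  have hkin : ∫⁻ X in cellN N L, realKinetic Ψ₀ X ≤ ENNReal.ofReal (lam - Pot) := by
    refine ENNReal.le_of_forall_pos_le_add fun ε hε _ => ?_
    have hε' : (0 : ℝ) < ε := by exact_mod_cast hε
    have hK' : lam - Pot < lam - Pot + ε := by linarith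
    have hev := sqIncrCell_div_eventually_le hv hL hC hcont hper hnn hnorm heig hK'
    calc ∫⁻ X in cellN N L, realKinetic Ψ₀ X
        ≤ liminf (fun t : ℝ≥0 => (ENNReal.ofReal (2 * t))⁻¹ * sqIncrCell L t Ψ₀) (𝓝[>] 0) :=
          kinetic_le_liminf_sqIncrCell L hC1
      _ ≤ liminf (fun _ : ℝ≥0 => ENNReal.ofReal (lam - Pot + ε)) (𝓝[>] 0) := liminf_le_liminf hev
      _ = ENNReal.ofReal (lam - Pot + ε) := liminf_const _
      _ ≤ ENNReal.ofReal (lam - Pot) + ENNReal.ofReal ε := ENNReal.ofReal_add_le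
      _ = ENNReal.ofReal (lam - Pot) + ε := by rw [ENNReal.ofReal_coe_nnreal]
  -- the trial state `X ↦ Ψ₀ X`
  have hnormΨ : ∫⁻ X in cellN N L, ((‖((Ψ₀ X : ℝ) : ℂ)‖₊ : ℝ≥0∞)) ^ 2 = 1 := by
    have h1 : ∀ X, ((‖((Ψ₀ X : ℝ) : ℂ)‖₊ : ℝ≥0∞)) ^ 2 = ENNReal.ofReal (Ψ₀ X) ^ 2 := fun X => by
      rw [ennnorm_sq_ofReal_periodic, ENNReal.ofReal_pow (hnn X)]
    simp_rw [h1]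
    exact hGS.norm_eq
  let Ψ : PeriodicTrialState N L :=
    { ψ := fun X => ((Ψ₀ X : ℝ) : ℂ)
      contDiff := Complex.ofRealCLM.contDiff.comp hC1
      periodic := fun X i k => by
        show ((Ψ₀ (X + Pi.single i (EuclideanSpace.single k L)) : ℝ) : ℂ) = ((Ψ₀ X : ℝ) : ℂ)
        rw [hper]
      symm := fun σ X => by
        show ((Ψ₀ (X ∘ σ) : ℝ) : ℂ) = ((Ψ₀ X : ℝ) : ℂ)
        rw [hGS.symm]
      norm_eq := hnormΨ }
  have hΨeq : Ψ.ψ = fun X => (((1 * Ψ₀ X : ℝ)) : ℂ) := by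
    funext X
    rw [one_mul]
  -- the energy identity
  have hE : periodicEnergy v Ψ = (∫⁻ X in cellN N L, realKinetic Ψ₀ X) +
      ∫⁻ X in cellN N L, ENNReal.ofReal (Ψ₀ X ^ 2) * periodicInteraction v L X := by
    rw [periodicEnergy_of_ofReal_mul Ψ hC1 hΨeq v, one_pow, ENNReal.ofReal_one, one_mul]
  have hEle : periodicEnergy v Ψ ≤ periodicGroundStateEnergy v N L := by
    rw [hE, hpotE, hE₀]
    calc (∫⁻ X in cellN N L, realKinetic Ψ₀ X) + ENNReal.ofReal Pot
        ≤ ENNReal.ofReal (lam - Pot) + ENNReal.ofReal Pot := add_le_add hkin le_rfl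
      _ = ENNReal.ofReal lam := by
          rw [← ENNReal.ofReal_add (sub_nonneg.2 hPotle) hPot0, sub_add_cancel]
  have hEeq : periodicEnergy v Ψ = periodicGroundStateEnergy v N L :=
    le_antisymm hEle (periodicGroundStateEnergy_le v Ψ)
  refine ⟨Ψ, hEeq, ?_, fun X => ?_, fun X => ?_⟩
  · rw [hEeq]; exact hGS.energy_ne_top
  · show ((Ψ₀ X : ℝ) : ℂ) = ((‖((Ψ₀ X : ℝ) : ℂ)‖ : ℝ) : ℂ)
    rw [Complex.norm_real, Real.norm_of_nonneg (hnn X)]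
  · show ((Ψ₀ X : ℝ) : ℂ) ≠ 0
    exact Complex.ofReal_ne_zero.2 (hpos X).ne'

end GroundState

/-! ## The stub, conditional on (α) and (β) -/

/-- **S6' `stub_boundedPositiveMinimiser`** — the registered stub of skeleton v2 of line `third-law-current-floor`
(the v1 statement made CONDITIONAL on the two named facts): given (α) the Perron–Frobenius–Feynman–Kac package on the
torus `PeriodicGroundStateFeynmanKac` (named fact of `PeriodicHeatFlowSpectral.lean`) and (β) the `C¹`-regularity of
its witness (elliptic regularity, inlined: `(−Δ+V)Ψ₀ = E₀Ψ₀` with `VΨ₀ ∈ L^∞` gives `W^{2,p}` for all `p`, hence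
`C^{1,α}`), every BOUNDED admissible `v`, every `n` and `L > 0` admit a strictly positive real `C¹` minimiser of the
periodic `(n+1)`-body energy, of finite energy. Proof: bounded periodisation (`exists_periodizedPotential_le`), the
witness from (α), its regularity from (β), and `positiveMinimiser_of_isPeriodicGroundStateFK`.
[cite: ReedSimonIV1978, Thm XIII.47] -/
theorem stub_boundedPositiveMinimiser :
    PeriodicGroundStateFeynmanKac →
    (∀ (N : ℕ) (L : ℝ) (v : ℝ → ℝ≥0∞), 1 ≤ N → 0 < L → Measurable v →
      (∃ C : ℝ≥0, ∀ x, periodizedPotential v L x ≤ C) →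
      ∀ Ψ₀ : Config N → ℝ, IsPeriodicGroundStateFK v L Ψ₀ → ContDiff ℝ 1 Ψ₀) →
    ∀ v : ℝ → ℝ≥0∞, IsRepulsiveFiniteRange v → (∃ M : ℝ≥0∞, M ≠ ⊤ ∧ ∀ r, v r ≤ M) →
      ∀ (n : ℕ) (L : ℝ), 0 < L → ∃ Ψ : PeriodicTrialState (n + 1) L,
        periodicEnergy v Ψ = periodicGroundStateEnergy v (n + 1) L ∧ periodicEnergy v Ψ ≠ ⊤ ∧
        (∀ X, Ψ.ψ X = (‖Ψ.ψ X‖ : ℂ)) ∧ (∀ X, Ψ.ψ X ≠ 0) := by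
  intro hFK hreg v hv hM n L hL
  obtain ⟨C, hC⟩ := exists_periodizedPotential_le hv hM hL
  have hN : 1 ≤ n + 1 := Nat.le_add_left 1 n
  obtain ⟨Ψ₀, hGS, -, hpos⟩ := hFK (n + 1) L v hN hL hv.1 ⟨C, hC⟩
  exact positiveMinimiser_of_isPeriodicGroundStateFK hL hv.1 hC hGS
    (hreg (n + 1) L v hN hL hv.1 ⟨C, hC⟩ Ψ₀ hGS) hpos

/-! ## Calibration: the case `n = 0` (`N = 1`) holds unconditionally -/

/-- **The stub at `n = 0`, unconditionally**: for one particle on the torus the constant state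
`L^{-3/2}` (`PeriodicTrialState.const`) is a strictly positive real minimiser of energy
`0 = periodicGroundStateEnergy v 1 L` (`periodicGroundStateEnergy_one`), for every `v` whatsoever.
[folklore] -/
theorem stub_boundedPositiveMinimiser_zero (v : ℝ → ℝ≥0∞) (L : ℝ) (hL : 0 < L) :
    ∃ Ψ : PeriodicTrialState (0 + 1) L,
      periodicEnergy v Ψ = periodicGroundStateEnergy v (0 + 1) L ∧ periodicEnergy v Ψ ≠ ⊤ ∧
      (∀ X, Ψ.ψ X = (‖Ψ.ψ X‖ : ℂ)) ∧ (∀ X, Ψ.ψ X ≠ 0) := by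
  have hE : periodicEnergy v (PeriodicTrialState.const hL) = 0 := by
    refine (lintegral_congr fun X => ?_).trans lintegral_zero
    simp [PeriodicTrialState.const, kineticDensity, periodicInteraction]
  have hsqrt : 0 < Real.sqrt (L ^ 3) := Real.sqrt_pos.2 (by positivity)
  refine ⟨PeriodicTrialState.const hL, ?_, ?_, fun X => ?_, fun X => ?_⟩
  · rw [hE]
    exact (periodicGroundStateEnergy_one hL v).symm
  · rw [hE]; exact ENNReal.zero_ne_top
  · show (((Real.sqrt (L ^ 3))⁻¹ : ℂ)) = ((‖((Real.sqrt (L ^ 3))⁻¹ : ℂ)‖ : ℝ) : ℂ)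
    rw [← Complex.ofReal_inv, Complex.norm_real, Real.norm_of_nonneg (inv_nonneg.2 hsqrt.le)]
  · show (((Real.sqrt (L ^ 3))⁻¹ : ℂ)) ≠ 0
    rw [← Complex.ofReal_inv]
    exact Complex.ofReal_ne_zero.2 (inv_ne_zero hsqrt.ne')

end Summit.AtomisticToContinuum.BoseEinsteinCondensation.Cruxes.HardCoreExtension.ThirdLawCurrentFloor

end
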